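import Mathlib.Algebra.Group.Subgroup.Lattice
import Mathlib.Algebra.Group.Pi.Basic
import Mathlib.Algebra.Module.Equiv.Basic
import Summits.ABC.IUTFork.Thm311Multirad

/-!
# [IUTchIII] Theorem 3.11 (i): the indeterminacy orbit — proofs over `Thm311Multirad`

PROOF-ONLY companion (no new definitions, no new signatures) to seat abc-iut-c312-1's record-only files
`Thm311Sig` (A) and `Thm311Multirad` (B) of the abc-iut cell; TAKES NO SIDE. Written by the wave-2
support seat abc-iut-L6-t13 (plan/WAVE2-SLICES.tsv row 63).

File B types "`^{n,∘}R^{LGP}` := the data (a), (b), (c) regarded up to the indeterminacies (Ind1), (Ind2)"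
([IUTchIII] Thm. 3.11 (i), kurims p. 154) as `MRData.RLGP D = {D' | EqvGen IndMoves D D'}`, the class of
`D` under the equivalence relation generated by single transports `D ↦ D.map Φ` along an (Ind1)-family or
an (Ind2)-family `Φ`. This file proves the [folklore] structure facts every consumer of that definition
needs and B does not carry:

* `MRData.map` is an ACTION of the group `L.PacketAut` of packet-automorphism families (Mathlib's
  `Pi.group` over `LinearEquiv.automorphismGroup`, so `(Φ * Ψ) j v_ℚ = (Ψ j v_ℚ).trans (Φ j v_ℚ)`):
  `map_one`, `map_mul` (`D.map (Φ * Ψ) = (D.map Ψ).map Φ`), `map_inv_map`, `map_map_inv`.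
* ORBIT THEOREM `mem_RLGP_iff`: `D' ∈ D.RLGP ↔ ∃ Φ ∈ Subgroup.closure (Ind1Family ∪ Ind2Family),
  D' = D.map Φ` — the equivalence class generated by single (Ind1)/(Ind2) moves is ONE ORBIT under the
  subgroup the two families generate (hypothesis-free: the closure supplies the inverses that the
  signature `LogShells`, which only records `one_mem_stripAut`/`one_mem_ism`, does not). Hence
  `RLGP_eq_image_closure`, `RLGP_map_eq_of_mem_closure`, and for the situation of Theorem 3.11 the reading
  `multiradialCompat_iff`: (i)'s concluding compatibility `^{n,∘}R^{LGP} = ^{n',∘}R^{LGP}` holds iff the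
  data of any two vertical lines differ by ONE element of the indeterminacy group.
* PROPAGATION `adm_and_logvol_eq_of_mem_closure`: B's `LogvolInvariant D` quantifies over the generating
  families at `D` only; what [IUTchIII] Cor. 3.12 / [IUTchIV] Thm. 1.10 Step (v) consume is constancy of
  the log-volume of an admissible region along the WHOLE orbit. The lemma states exactly the extra
  hypothesis under which the former gives the latter — admissibility `Adm` is carried to admissibility by
  every generating move, in both directions — and proves it by closure induction.

Sources read on the page: [IUTchIII] kurims pp. 153–155 (Thm. 3.11 (i), (Ind1), (Ind2)).
[claim: Mochizuki2012, status: disputed] for the quoted statement; every theorem below is [folklore]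
(elementary group-action bookkeeping) and assumes nothing about Theorem 3.11.
Deliberately NOT here: any instance/definition (the action is used through `map` only, so that this file
stays proof-only); (ii), (iii), (Ind3); any judgement.
-/

namespace Summit.ABC

namespace IUTFork

namespace Thm311

variable {T : ThetaIndex} {L : LogShells T}

namespace LogShells

/-- `starAut` of the identity family is the identity of `∏_{j ∈ F_l^⋇}`. [folklore] -/
theorem starAut_one (v : T.V) : L.starAut 1 v = LinearEquiv.refl ℚ _ := rfl

/-- `starAut` is multiplicative: the family `Φ * Ψ` (i.e. `Ψ` then `Φ`) acts on `∏_{j ∈ F_l^⋇}` by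
`starAut Ψ` then `starAut Φ`. [folklore] -/
theorem starAut_mul (Φ Ψ : L.PacketAut) (v : T.V) :
    L.starAut (Φ * Ψ) v = (L.starAut Ψ v).trans (L.starAut Φ v) := rfl

/-- `globalAut` of the identity family is the identity of `∏_{v_ℚ}`. [folklore] -/
theorem globalAut_one (j : T.Label) : L.globalAut 1 j = LinearEquiv.refl ℚ _ := rfl

/-- `globalAut` is multiplicative (same convention as `starAut_mul`). [folklore] -/
theorem globalAut_mul (Φ Ψ : L.PacketAut) (j : T.Label) :
    L.globalAut (Φ * Ψ) j = (L.globalAut Ψ j).trans (L.globalAut Φ j) := rfl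

end LogShells

namespace MRData

/-- Two collections of data (a), (b), (c) are equal when their seven fields are. [folklore] -/
theorem ext' : ∀ {D D' : MRData L}, D.shellPk = D'.shellPk → D.shellSub = D'.shellSub → D.Adm = D'.Adm →
    D.logvol = D'.logvol → D.Ψ = D'.Ψ → D.act = D'.act → D.Mmod = D'.Mmod → D = D'
  | ⟨_, _, _, _, _, _, _⟩, ⟨_, _, _, _, _, _, _⟩, rfl, rfl, rfl, rfl, rfl, rfl, rfl => rfl

/-- Transport along the identity family does nothing. [folklore] -/
theorem map_one (D : MRData L) : D.map 1 = D := by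
  refine ext' ?_ ?_ ?_ ?_ ?_ ?_ ?_
  · funext j vQ
    change ((LinearEquiv.refl ℚ _ : L.Packet j vQ ≃ₗ[ℚ] L.Packet j vQ) : _ → _) '' _ = _
    simp
  · funext j v
    change ((LinearEquiv.refl ℚ _ : L.Packet j (T.over v) ≃ₗ[ℚ] L.Packet j (T.over v)) : _ → _) '' _ = _
    simp
  · funext j vQ A
    change D.Adm j vQ (((LinearEquiv.refl ℚ _ : L.Packet j vQ ≃ₗ[ℚ] L.Packet j vQ).symm : _ → _) '' A) = _
    simp
  · funext j vQ A
    change D.logvol j vQ (((LinearEquiv.refl ℚ _ : L.Packet j vQ ≃ₗ[ℚ] L.Packet j vQ).symm : _ → _) '' A) = _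
    simp
  · funext v hv
    change ((L.starAut 1 v) : _ → _) '' _ = _
    rw [LogShells.starAut_one]
    simp
  · funext v hv y
    change (L.starAut 1 v).toLinearMap ∘ₗ D.act v hv ((L.starAut 1 v).symm y) ∘ₗ
      (L.starAut 1 v).symm.toLinearMap = _
    rw [LogShells.starAut_one]
    rfl
  · funext j
    change ((L.globalAut 1 j.1) : _ → _) '' _ = _
    rw [LogShells.globalAut_one]
    simp

/-- Transport is an ACTION: along `Φ * Ψ` (that is, `Ψ` followed by `Φ`) it is transport along `Ψ`
followed by transport along `Φ`. [folklore] -/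
theorem map_mul (D : MRData L) (Φ Ψ : L.PacketAut) : D.map (Φ * Ψ) = (D.map Ψ).map Φ := by
  refine ext' ?_ ?_ ?_ ?_ ?_ ?_ ?_
  · funext j vQ
    change (((Ψ j vQ).trans (Φ j vQ)) : _ → _) '' _ = ((Φ j vQ) : _ → _) '' (((Ψ j vQ) : _ → _) '' _)
    rw [Set.image_image]; rfl
  · funext j v
    change (((Ψ j _).trans (Φ j _)) : _ → _) '' _ = ((Φ j _) : _ → _) '' (((Ψ j _) : _ → _) '' _)
    rw [Set.image_image]; rfl
  · funext j vQ A
    change D.Adm j vQ ((((Ψ j vQ).trans (Φ j vQ)).symm : _ → _) '' A) =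
      D.Adm j vQ (((Ψ j vQ).symm : _ → _) '' ((((Φ j vQ)).symm : _ → _) '' A))
    rw [Set.image_image]; rfl
  · funext j vQ A
    change D.logvol j vQ ((((Ψ j vQ).trans (Φ j vQ)).symm : _ → _) '' A) =
      D.logvol j vQ (((Ψ j vQ).symm : _ → _) '' ((((Φ j vQ)).symm : _ → _) '' A))
    rw [Set.image_image]; rfl
  · funext v hv
    change ((L.starAut (Φ * Ψ) v) : _ → _) '' _ =
      ((L.starAut Φ v) : _ → _) '' (((L.starAut Ψ v) : _ → _) '' _)
    rw [LogShells.starAut_mul, Set.image_image]; rfl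
  · funext v hv y
    change (L.starAut (Φ * Ψ) v).toLinearMap ∘ₗ D.act v hv ((L.starAut (Φ * Ψ) v).symm y) ∘ₗ
        (L.starAut (Φ * Ψ) v).symm.toLinearMap =
      (L.starAut Φ v).toLinearMap ∘ₗ ((L.starAut Ψ v).toLinearMap ∘ₗ
        D.act v hv ((L.starAut Ψ v).symm ((L.starAut Φ v).symm y)) ∘ₗ (L.starAut Ψ v).symm.toLinearMap) ∘ₗ
        (L.starAut Φ v).symm.toLinearMap
    rw [LogShells.starAut_mul]
    rfl
  · funext j
    change ((L.globalAut (Φ * Ψ) j.1) : _ → _) '' _ =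
      ((L.globalAut Φ j.1) : _ → _) '' (((L.globalAut Ψ j.1) : _ → _) '' _)
    rw [LogShells.globalAut_mul, Set.image_image]; rfl

/-- Transport along `Φ⁻¹` undoes transport along `Φ`. [folklore] -/
theorem map_inv_map (D : MRData L) (Φ : L.PacketAut) : (D.map Φ).map Φ⁻¹ = D := by
  rw [← map_mul, inv_mul_cancel, map_one]

/-- Transport along `Φ` undoes transport along `Φ⁻¹`. [folklore] -/
theorem map_map_inv (D : MRData L) (Φ : L.PacketAut) : (D.map Φ⁻¹).map Φ = D := by
  rw [← map_mul, mul_inv_cancel, map_one]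

/-- Transport is injective in the data. [folklore] -/
theorem map_injective (Φ : L.PacketAut) : Function.Injective fun D : MRData L => D.map Φ := by
  intro D D' h
  have := congrArg (fun E : MRData L => E.map Φ⁻¹) h
  simpa only [map_inv_map] using this

/-- A single indeterminacy move is transport along a member of `Ind1Family ∪ Ind2Family`. [folklore] -/
theorem indMoves_iff (D D' : MRData L) :
    IndMoves D D' ↔ ∃ Φ ∈ L.Ind1Family ∪ L.Ind2Family, D' = D.map Φ := by
  simp only [IndMoves, Set.mem_union]

/-- Every element of the subgroup generated by the (Ind1)- and (Ind2)-families transports any data to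
data in the same class. [folklore] -/
theorem eqvGen_indMoves_map_of_mem_closure {Φ : L.PacketAut}
    (hΦ : Φ ∈ Subgroup.closure (L.Ind1Family ∪ L.Ind2Family)) :
    ∀ D : MRData L, Relation.EqvGen IndMoves D (D.map Φ) := by
  induction hΦ using Subgroup.closure_induction with
  | mem Φ hΦ => exact fun D => Relation.EqvGen.rel _ _ ((indMoves_iff D _).2 ⟨Φ, hΦ, rfl⟩)
  | one => intro D; rw [map_one]; exact Relation.EqvGen.refl D
  | mul Φ Ψ _ _ ihΦ ihΨ =>
    intro D; rw [map_mul]; exact Relation.EqvGen.trans _ _ _ (ihΨ D) (ihΦ (D.map Ψ))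
  | inv Φ _ ih =>
    intro D
    have h := ih (D.map Φ⁻¹)
    rw [map_map_inv] at h
    exact Relation.EqvGen.symm _ _ h

/-- **Orbit theorem.** Two data are related by the equivalence relation GENERATED by single
(Ind1)/(Ind2) moves iff the second is the transport of the first along an element of the SUBGROUP
generated by the (Ind1)- and (Ind2)-families. [folklore] -/
theorem eqvGen_indMoves_iff (D D' : MRData L) :
    Relation.EqvGen IndMoves D D' ↔
      ∃ Φ ∈ Subgroup.closure (L.Ind1Family ∪ L.Ind2Family), D' = D.map Φ := by
  constructor
  · intro h
    induction h with
    | rel x y hxy =>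
      obtain ⟨Φ, hΦ, rfl⟩ := (indMoves_iff x y).1 hxy
      exact ⟨Φ, Subgroup.subset_closure hΦ, rfl⟩
    | refl x => exact ⟨1, one_mem _, (map_one x).symm⟩
    | symm x y _ ih =>
      obtain ⟨Φ, hΦ, rfl⟩ := ih
      exact ⟨Φ⁻¹, inv_mem hΦ, (map_inv_map x Φ).symm⟩
    | trans x y z _ _ ih₁ ih₂ =>
      obtain ⟨Φ, hΦ, rfl⟩ := ih₁
      obtain ⟨Ψ, hΨ, rfl⟩ := ih₂
      exact ⟨Ψ * Φ, mul_mem hΨ hΦ, (map_mul x Ψ Φ).symm⟩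
  · rintro ⟨Φ, hΦ, rfl⟩
    exact eqvGen_indMoves_map_of_mem_closure hΦ D

/-- **`R^LGP` is one orbit**: `D' ∈ ^{n,∘}R^{LGP}(D)` iff `D'` is the transport of `D` along an element of
the indeterminacy subgroup `⟨Ind1Family ∪ Ind2Family⟩ ≤ PacketAut`. [folklore] -/
theorem mem_RLGP_iff (D D' : MRData L) :
    D' ∈ D.RLGP ↔ ∃ Φ ∈ Subgroup.closure (L.Ind1Family ∪ L.Ind2Family), D' = D.map Φ :=
  eqvGen_indMoves_iff D D'

/-- `R^LGP(D)` = the image of the indeterminacy subgroup under `Φ ↦ D.map Φ` ("the possible images of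
`D`"). [folklore] -/
theorem RLGP_eq_image_closure (D : MRData L) :
    D.RLGP = (fun Φ : L.PacketAut => D.map Φ) ''
      (Subgroup.closure (L.Ind1Family ∪ L.Ind2Family) : Set L.PacketAut) := by
  ext D'
  rw [mem_RLGP_iff, Set.mem_image]
  constructor
  · rintro ⟨Φ, hΦ, rfl⟩; exact ⟨Φ, hΦ, rfl⟩
  · rintro ⟨Φ, hΦ, rfl⟩; exact ⟨Φ, hΦ, rfl⟩

/-- Transport along an element of the indeterminacy subgroup stays in the class. [folklore] -/
theorem map_mem_RLGP (D : MRData L) {Φ : L.PacketAut}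
    (hΦ : Φ ∈ Subgroup.closure (L.Ind1Family ∪ L.Ind2Family)) : D.map Φ ∈ D.RLGP :=
  (mem_RLGP_iff D _).2 ⟨Φ, hΦ, rfl⟩

/-- Transport along an element of the indeterminacy SUBGROUP does not change the class (the generator
case `Φ ∈ Ind1Family ∨ Φ ∈ Ind2Family` is abc-iut-c312-1's `MRData.RLGP_map_eq`, file F `Thm311Remarks`,
its reading of Rmk. 3.11.1 (ii)). [folklore] -/
theorem RLGP_map_eq_of_mem_closure (D : MRData L) {Φ : L.PacketAut}
    (hΦ : Φ ∈ Subgroup.closure (L.Ind1Family ∪ L.Ind2Family)) : (D.map Φ).RLGP = D.RLGP :=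
  ((RLGP_eq_iff _ _).2 (Relation.EqvGen.symm _ _ (eqvGen_indMoves_map_of_mem_closure hΦ D)))

/-- **Propagation of log-volume invariance along the orbit.** B's `LogvolInvariant D` says: every
GENERATING move out of `D` preserves the log-volume of every `D`-admissible region. If, in addition, the
generating moves carry admissible regions to admissible regions in both directions (as compact open
subsets are carried by homeomorphisms — a property of the INSTANTIATED signature, assumed here by name),
then every element of the whole indeterminacy SUBGROUP preserves admissibility and log-volume — the form
in which [IUTchIII] Cor. 3.12 ("the possible images") and [IUTchIV] Thm. 1.10, Step (v) consume (Ind1),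
(Ind2), and literally the body of abc-iut-c312-1's `LatticeSituation.LogvolIndInvariant S n j v_ℚ` (file G
`Thm311Pilot`, `IndGroup := Subgroup.closure (Ind1Family ∪ Ind2Family)`) at `D = S.D n`: so G's
whole-group hypothesis REDUCES to B's generator-level `LogvolInvariant` plus admissibility transport by
the generating families. [folklore] -/
theorem adm_iff_and_logvol_eq_of_mem_closure (D : MRData L)
    (hAdm : ∀ Φ ∈ L.Ind1Family ∪ L.Ind2Family, ∀ j vQ (A : Set (L.Packet j vQ)),
      D.Adm j vQ A ↔ D.Adm j vQ (Φ j vQ '' A))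
    (hvol : D.LogvolInvariant) {Φ : L.PacketAut}
    (hΦ : Φ ∈ Subgroup.closure (L.Ind1Family ∪ L.Ind2Family)) :
    ∀ j vQ (A : Set (L.Packet j vQ)),
      (D.Adm j vQ A ↔ D.Adm j vQ (Φ j vQ '' A)) ∧
        (D.Adm j vQ A → D.logvol j vQ (Φ j vQ '' A) = D.logvol j vQ A) := by
  induction hΦ using Subgroup.closure_induction with
  | mem Φ hΦ =>
    intro j vQ A
    exact ⟨hAdm Φ hΦ j vQ A, hvol Φ ((Set.mem_union _ _ _).1 hΦ) j vQ A⟩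
  | one =>
    intro j vQ A
    have h1 : ((1 : L.PacketAut) j vQ : L.Packet j vQ → L.Packet j vQ) '' A = A := by
      change ((LinearEquiv.refl ℚ _ : L.Packet j vQ ≃ₗ[ℚ] L.Packet j vQ) : _ → _) '' A = A
      simp
    rw [h1]; exact ⟨Iff.rfl, fun _ => rfl⟩
  | mul Φ Ψ _ _ ihΦ ihΨ =>
    intro j vQ A
    have hmul : ((Φ * Ψ) j vQ : L.Packet j vQ → L.Packet j vQ) '' A = Φ j vQ '' (Ψ j vQ '' A) := by
      change (((Ψ j vQ).trans (Φ j vQ)) : _ → _) '' A = _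
      rw [Set.image_image]; rfl
    obtain ⟨hΨA, hΨvol⟩ := ihΨ j vQ A
    obtain ⟨hΦΨA, hΦvol⟩ := ihΦ j vQ (Ψ j vQ '' A)
    rw [hmul]
    exact ⟨hΨA.trans hΦΨA, fun hA => (hΦvol (hΨA.1 hA)).trans (hΨvol hA)⟩
  | inv Φ _ ih =>
    intro j vQ A
    -- `A = Φ '' (Φ⁻¹ '' A)`, so the statement for `Φ` at `Φ⁻¹ '' A` is the statement for `Φ⁻¹` at `A`.
    have hback : ((Φ j vQ : L.Packet j vQ → L.Packet j vQ)) '' ((Φ⁻¹ j vQ : _ → _) '' A) = A := by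
      change ((Φ j vQ) : _ → _) '' (((Φ j vQ).symm : _ → _) '' A) = A
      rw [Set.image_image]; simp
    obtain ⟨hadm, hv⟩ := ih j vQ ((Φ⁻¹ j vQ : _ → _) '' A)
    rw [hback] at hadm hv
    exact ⟨hadm.symm, fun hA => (hv (hadm.2 hA)).symm⟩

/-- The one-directional form of `adm_iff_and_logvol_eq_of_mem_closure`: along the whole indeterminacy
subgroup, admissible regions go to admissible regions of the same log-volume. [folklore] -/
theorem adm_and_logvol_eq_of_mem_closure (D : MRData L)
    (hAdm : ∀ Φ ∈ L.Ind1Family ∪ L.Ind2Family, ∀ j vQ (A : Set (L.Packet j vQ)),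
      D.Adm j vQ A ↔ D.Adm j vQ (Φ j vQ '' A))
    (hvol : D.LogvolInvariant) {Φ : L.PacketAut}
    (hΦ : Φ ∈ Subgroup.closure (L.Ind1Family ∪ L.Ind2Family))
    (j : T.Label) (vQ : T.VQ) (A : Set (L.Packet j vQ)) (hA : D.Adm j vQ A) :
    D.Adm j vQ (Φ j vQ '' A) ∧ D.logvol j vQ (Φ j vQ '' A) = D.logvol j vQ A :=
  have h := adm_iff_and_logvol_eq_of_mem_closure D hAdm hvol hΦ j vQ A
  ⟨h.1.1 hA, h.2 hA⟩

/-- Consequently, under the same hypotheses, EVERY possible image `D' ∈ R^LGP(D)` assigns to the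
transported region the log-volume `D` assigns to the region: `D'.logvol (Φ '' A) = D.logvol A` where
`D' = D.map Φ` — indeed `D'.logvol (Φ '' A) = D.logvol (Φ⁻¹ '' (Φ '' A)) = D.logvol A` by the very
definition of transport, with no hypothesis at all. Recorded to make explicit that the CONTENT of
log-volume invariance is about comparing `D.logvol (Φ '' A)` with `D.logvol A` for the SAME `D`
(`adm_and_logvol_eq_of_mem_closure`), not about the transported data. [folklore] -/
theorem map_logvol_image (D : MRData L) (Φ : L.PacketAut) (j : T.Label) (vQ : T.VQ)
    (A : Set (L.Packet j vQ)) : (D.map Φ).logvol j vQ (Φ j vQ '' A) = D.logvol j vQ A := by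
  change D.logvol j vQ (((Φ j vQ).symm : _ → _) '' ((Φ j vQ : _ → _) '' A)) = _
  rw [Set.image_image]; simp

end MRData

namespace Situation

variable (S : Situation T)

/-- **Reading of Theorem 3.11 (i)'s concluding compatibility in the bi-coric strictification.**
`MultiradialCompat S` (`^{n,∘}R^{LGP} = ^{n',∘}R^{LGP}` for all `n, n'`) holds iff the data (a), (b), (c)
of any two vertical lines of the log-theta-lattice differ by ONE element of the indeterminacy subgroup
`⟨Ind1Family ∪ Ind2Family⟩`: `S.D n' = (S.D n).map Φ`. Neither side is asserted. [folklore] -/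
theorem multiradialCompat_iff :
    S.MultiradialCompat ↔ ∀ n n' : ℤ, ∃ Φ ∈ Subgroup.closure (S.L.Ind1Family ∪ S.L.Ind2Family),
      S.D n' = (S.D n).map Φ := by
  constructor
  · intro h n n'
    exact (MRData.mem_RLGP_iff _ _).1 (S.mem_RLGP_of_multiradialCompat h n n')
  · intro h n n'
    obtain ⟨Φ, hΦ, e⟩ := h n n'
    change (S.D n).RLGP = (S.D n').RLGP
    rw [e, MRData.RLGP_map_eq_of_mem_closure _ hΦ]

/-- Under (i): for every pair of vertical lines there is an element of the indeterminacy subgroup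
transporting the data of the one to the data of the other ("possible images", as Cor. 3.12 uses (i)).
[folklore] -/
theorem exists_map_eq_of_multiradialCompat (h : S.MultiradialCompat) (n n' : ℤ) :
    ∃ Φ ∈ Subgroup.closure (S.L.Ind1Family ∪ S.L.Ind2Family), S.D n' = (S.D n).map Φ :=
  (multiradialCompat_iff S).1 h n n'

end Situation

end Thm311

end IUTFork

end Summit.ABC
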